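import Mathlib
import HarnessLib
import Summits.NavierStokesRegularity.NavierStokesRegularity.Theses.SubOnsagerCeiling
import Summits.NavierStokesRegularity.NavierStokesRegularity.Theorems.SubOnsagerCeilingDefs
import Summits.NavierStokesRegularity.NavierStokesRegularity.Theorems.SubOnsagerCeilingOrthantTailCeilingDyadicRatioTwo

set_option linter.unusedVariables false

/-! # Birth skeleton (BC3) «fwd-shell-barrier» for the crux `SubOnsagerCeiling.ForwardTailCeiling` (stmt-NavierStokesRegularity-26608)
Planner ns-idea-1 g5, 2026-08-28. MODEL LATTICE ONLY (rung TL-M2Break); no summit is proved by a line.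
Shape = the lead's registered line «shell-barrier» (Cruxes/OrthantTailCeiling/Lines/shell_barrier.lean) transported to the
FORWARD-SOURCE observable: `FwdCeilingAt R ε₀ α` is the per-table body of the crux (∃ S ⊇ S⁺(α), ∃ θ > 1/2, ∃ C, ∀ ν …, bound on
Σ_(k=n..N) Σ_(i∈S) ½X²). Stubs by scale-ratio regime; composition by case split on ε₀ ≤ 1/4. The landed rung
`Theorems.SubOnsagerCeiling.stub_dyadicRatioTwo` (scaled dyadic tables, ε₀ = 1: CeilingAt via ShellBarrierAt, θ = 51/100) gives
`FwdCeilingAt` on that sub-class with S = univ (lemma `fwdCeilingAt_of_ceilingAt`, proved below) — the BC5 witness of weakness for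
the large-ratio stub. Instrument: kit j302483 / j302646 (RESULT-j302483.md on the item). -/

open Summit.NavierStokesRegularity.NavierStokesRegularity.Theses.SubOnsagerCeiling
open Summit.NavierStokesRegularity.NavierStokesRegularity.Theorems.SubOnsagerCeiling

namespace Summit.NavierStokesRegularity.NavierStokesRegularity.Cruxes.ForwardTailCeiling.FwdShellBarrier

/-- Per-table body of `ForwardTailCeiling`. -/
def FwdCeilingAt (R ε₀ : ℝ) (α : Fin 4 → Fin 4 → Fin 4 → ℤ × ℤ × ℤ → ℝ) : Prop :=
  Literature.Analysis.FluidPDE.TaoCascade.InTableClass R α → (∀ (Y : Fin 4 → ℤ → ℝ → ℝ) (τ : ℝ), (∀ (j : Fin 4) (k : ℤ), 1 ≤ k → 0 ≤ Y j k τ) → ∀ δ : ℝ, 0 < δ → ∀ (i : Fin 4) (n : ℤ), 1 ≤ n → Y i n τ = 0 → 0 ≤ Literature.Analysis.FluidPDE.TaoCascade.quadTerm δ α Y i n τ) → ∃ S : Finset (Fin 4), (∀ i, i ∉ S → ∀ j l : Fin 4, α i j l (0, 0, 1) = 0) ∧ ∃ θ : ℝ, 1 / 2 < θ ∧ ∃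 C : ℝ, 0 ≤ C ∧ ∀ ν : ℝ, 0 < ν → ∀ (X₀ : Fin 4 → ℝ) (s : ℝ), 0 < s → ∀ X : Fin 4 → ℤ → ℝ → ℝ, (∀ (i : Fin 4) (k : ℤ), X i k 0 = if k = 0 then X₀ i else 0) → (∀ (i : Fin 4) (k : ℤ), k < 0 → ∀ t : ℝ, X i k t = 0) → (∃ M : ℝ, ∀ (t : ℝ) (i : Fin 4) (k : ℤ), (1 + (1 + ε₀) ^ ((10 : ℝ) * k)) * |X i k t| ≤ M) → (∀ (i : Fin 4) (k : ℤ), Continuous (X i k)) → (∀ (i : Fin 4) (k : ℤ), ∀ t ∈ Set.Icc (0 : ℝ) s, HasDerivWithinAt (X i k) (Literature.Analysis.FluidPDE.TaoCascade.quadTerm ε₀ α X i k t - ν * (1 + ε₀) ^ ((2 : ℝ) * k) * X i k t) (Set.Icc (0 : ℝ) s) t) → (∀ t ∈ Set.Icc (0 : ℝ) s, ∀ (i : Fin 4) (k : ℤ), 1 ≤ k → 0 ≤ X i k t) → ∀ n N : ℕ, n ≤ N → ∀ t ∈ Set.Icc (0 : ℝ) s, ∑ k ∈ Finset.Icc n N,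 ∑ i ∈ S, (1 / 2 : ℝ) * X i (k : ℤ) t ^ 2 ≤ C * (∑ i : Fin 4, (1 / 2 : ℝ) * X₀ i ^ 2) * (1 + ε₀) ^ (-(2 * θ * (n : ℝ)))

theorem forwardTailCeiling_iff :
    ForwardTailCeiling ↔ ∀ R : ℝ, 1 ≤ R → ∀ ε₀ : ℝ, 0 < ε₀ → ε₀ ≤ 1 →
      ∀ α : Fin 4 → Fin 4 → Fin 4 → ℤ × ℤ × ℤ → ℝ, FwdCeilingAt R ε₀ α := Iff.rfl

/-- total-energy ceiling ⇒ forward-source ceiling (S = univ); so every landed `CeilingAt` rung transfers. -/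
theorem fwdCeilingAt_of_ceilingAt {R ε₀ : ℝ} {α : Fin 4 → Fin 4 → Fin 4 → ℤ × ℤ × ℤ → ℝ}
    (h : CeilingAt R ε₀ α) : FwdCeilingAt R ε₀ α := by
  intro hα hO
  obtain ⟨θ, hθ, C, hC, H⟩ := h hα hO
  refine ⟨Finset.univ, fun i hi => absurd (Finset.mem_univ i) hi, θ, hθ, C, hC, ?_⟩
  intro ν hν X₀ s hs X hX0 hXneg hM hXc hXd hXpos n N hnN t ht
  simpa using H ν hν X₀ s hs X hX0 hXneg hM hXc hXd hXpos n N hnN t ht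

/-- Copied verbatim from the lead's registered skeleton Cruxes/OrthantTailCeiling/Lines/shell_barrier.lean (proved there; that module is not built on the farm, hence the copy). -/
theorem ceilingAt_of_shellBarrier {R ε₀ : ℝ} (hε : 0 < ε₀)
    {α : Fin 4 → Fin 4 → Fin 4 → ℤ × ℤ × ℤ → ℝ} (h : ShellBarrierAt R ε₀ α) : CeilingAt R ε₀ α := by
  intro hT hO
  obtain ⟨θ, hθ, D, hD, H⟩ := h hT hO
  have hb : (1 : ℝ) < 1 + ε₀ := by linarith
  have hb0 : (0 : ℝ) ≤ 1 + ε₀ := by linarith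
  set r : ℝ := (1 + ε₀) ^ (-(2 * θ)) with hr_def
  have hr0 : 0 < r := Real.rpow_pos_of_pos (by linarith) _
  have hr1 : r < 1 := by
    have : (1 + ε₀) ^ (-(2 * θ)) < (1 + ε₀) ^ (0 : ℝ) :=
      Real.rpow_lt_rpow_of_exponent_lt hb (by linarith)
    simpa [hr_def] using this
  have h1r : 0 < 1 - r := by linarith
  refine ⟨θ, hθ, 4 * D / (1 - r), by positivity, ?_⟩
  intro ν hν X₀ s hs X hdat hvan hbdd hcont hode hnn n N hnN t ht
  set E₀ : ℝ := ∑ j : Fin 4, (1 / 2 : ℝ) * X₀ j ^ 2 with hE₀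
  have hE₀0 : 0 ≤ E₀ := Finset.sum_nonneg fun j _ => by positivity
  -- per-shell bound: ∑_i ½ X_{i,k}(t)² ≤ 4·D·E₀·r^k
  have hpow : ∀ k : ℕ, (1 + ε₀) ^ (2 * θ * (k : ℝ)) * r ^ k = 1 := by
    intro k
    rw [hr_def, ← Real.rpow_mul_natCast hb0, ← Real.rpow_add (by linarith)]
    have : 2 * θ * (k : ℝ) + -(2 * θ) * (k : ℝ) = 0 := by ring
    rw [this, Real.rpow_zero]
  have hshell : ∀ k : ℕ, ∑ i : Fin 4, (1 / 2 : ℝ) * X i (k : ℤ) t ^ 2 ≤ 4 * D * E₀ * r ^ k := by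
    intro k
    have hk : ∀ i : Fin 4, (1 / 2 : ℝ) * X i (k : ℤ) t ^ 2 ≤ D * E₀ * r ^ k := by
      intro i
      have Hi := H ν hν X₀ s hs X hdat hvan hbdd hcont hode hnn t ht i k
      have hw : 0 < (1 + ε₀) ^ (2 * θ * (k : ℝ)) := Real.rpow_pos_of_pos (by linarith) _
      have hrk : 0 < r ^ k := pow_pos hr0 k
      -- multiply Hi by r^k and use hpow
      have := mul_le_mul_of_nonneg_right Hi hrk.le
      calc (1 / 2 : ℝ) * X i (k : ℤ) t ^ 2
          = ((1 + ε₀) ^ (2 * θ * (k : ℝ)) * r ^ k) * ((1 / 2 : ℝ) * X i (k : ℤ) t ^ 2) := by rw [hpow k, one_mul]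
        _ = (1 + ε₀) ^ (2 * θ * (k : ℝ)) * ((1 / 2 : ℝ) * X i (k : ℤ) t ^ 2) * r ^ k := by ring
        _ ≤ D * (∑ j : Fin 4, (1 / 2 : ℝ) * X₀ j ^ 2) * r ^ k := this
        _ = D * E₀ * r ^ k := by rw [hE₀]
    calc ∑ i : Fin 4, (1 / 2 : ℝ) * X i (k : ℤ) t ^ 2
        ≤ ∑ _i : Fin 4, D * E₀ * r ^ k := Finset.sum_le_sum fun i _ => hk i
      _ = 4 * D * E₀ * r ^ k := by simp [Finset.sum_const, Finset.card_univ, Fintype.card_fin]; ring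
  -- sum over the shells n ≤ k ≤ N: geometric series
  have hgeom : ∑ k ∈ Finset.Icc n N, r ^ k ≤ r ^ n / (1 - r) := by
    rw [← Finset.Ico_add_one_right_eq_Icc]
    exact geom_sum_Ico_le_of_lt_one hr0.le hr1
  have hrn : r ^ n = (1 + ε₀) ^ (-(2 * θ * (n : ℝ))) := by
    rw [hr_def, ← Real.rpow_mul_natCast hb0]
    congr 1; ring
  calc ∑ k ∈ Finset.Icc n N, ∑ i : Fin 4, (1 / 2 : ℝ) * X i (k : ℤ) t ^ 2
      ≤ ∑ k ∈ Finset.Icc n N, 4 * D * E₀ * r ^ k := Finset.sum_le_sum fun k _ => hshell k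
    _ = 4 * D * E₀ * ∑ k ∈ Finset.Icc n N, r ^ k := by rw [Finset.mul_sum (s := Finset.Icc n N)]
    _ ≤ 4 * D * E₀ * (r ^ n / (1 - r)) :=
        mul_le_mul_of_nonneg_left hgeom (by positivity)
    _ = 4 * D / (1 - r) * E₀ * (1 + ε₀) ^ (-(2 * θ * (n : ℝ))) := by rw [← hrn]; field_simp
    _ = 4 * D / (1 - r) * (∑ i : Fin 4, (1 / 2 : ℝ) * X₀ i ^ 2) * (1 + ε₀) ^ (-(2 * θ * (n : ℝ))) := by
        rw [hE₀]

/-- RUNG (landed, p610572): scaled dyadic tables at ε₀ = 1 satisfy the forward ceiling. -/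
theorem rung_dyadicRatioTwo : ∀ R : ℝ, 1 ≤ R → ∀ α : Fin 4 → Fin 4 → Fin 4 → ℤ × ℤ × ℤ → ℝ,
    IsScaledDyadic α → FwdCeilingAt R 1 α := by
  intro R hR α hα
  have h := Summit.NavierStokesRegularity.NavierStokesRegularity.Theorems.SubOnsagerCeiling.stub_dyadicRatioTwo
  exact fwdCeilingAt_of_ceilingAt (ceilingAt_of_shellBarrier one_pos (h R hR α hα))

/-- Registered stub statement STUB 1 (large ratio, 1/4 < ε₀ ≤ 1): nested BMR/CZ-type weighted shell barriers on the SOURCE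
sub-network of an orthant table, certified on a grid of bases and glued by continuity in b; dead-end pockets are outside S and
ignored, pockets with an exit saturate at Kolmogorov level (lead's §3; RESULT-j302646 rows L_*: Θ⁺ ≥ 1.43 at ε₀ = 1, 1/2). -/
def Sig.stub_fwdCeilingLargeRatio : Prop := ∀ R : ℝ, 1 ≤ R → ∀ ε₀ : ℝ, 1 / 4 < ε₀ → ε₀ ≤ 1 →
    ∀ α : Fin 4 → Fin 4 → Fin 4 → ℤ × ℤ × ℤ → ℝ, FwdCeilingAt R ε₀ α

/-- Registered stub statement STUB 2 (small ratio, 0 < ε₀ ≤ 1/4; HARDEST): the discrete front exponent of the source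
sub-network stays > 1/2 as b ↓ 1 (first-crossing shell on the block-averaged lattice, stencil ≍ 1/ε₀; measured W⁺ plateaux
1.571 / 1.257 / 1.303 at 1/4, 1/8, 1/16, lowest 1.297 for the braid at 1/8). -/
def Sig.stub_fwdCeilingSmallRatio : Prop := ∀ R : ℝ, 1 ≤ R → ∀ ε₀ : ℝ, 0 < ε₀ → ε₀ ≤ 1 / 4 →
    ∀ α : Fin 4 → Fin 4 → Fin 4 → ℤ × ℤ × ℤ → ℝ, FwdCeilingAt R ε₀ α

theorem stub_fwdCeilingLargeRatio : Sig.stub_fwdCeilingLargeRatio := by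
  sorry

theorem stub_fwdCeilingSmallRatio : Sig.stub_fwdCeilingSmallRatio := by
  sorry

/-- Composition: the two regime stubs give the crux BY NAME (the landed rung `rung_dyadicRatioTwo` is the proved ε₀ = 1
dyadic corner of STUB 1, kept in the case split as in the lead's v4). -/
theorem ForwardTailCeiling_of :
    Sig.stub_fwdCeilingLargeRatio → Sig.stub_fwdCeilingSmallRatio →
      Summit.NavierStokesRegularity.NavierStokesRegularity.Theses.SubOnsagerCeiling.ForwardTailCeiling := by
  intro h1 h2
  rw [forwardTailCeiling_iff]
  intro R hR ε₀ h0 hle α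
  by_cases hq : ε₀ ≤ 1 / 4
  · exact h2 R hR ε₀ h0 hq α
  · by_cases hd : ε₀ = 1 ∧ IsScaledDyadic α
    · obtain ⟨rfl, hα⟩ := hd
      exact rung_dyadicRatioTwo R hR α hα
    · exact h1 R hR ε₀ (lt_of_not_ge hq) hle α

end Summit.NavierStokesRegularity.NavierStokesRegularity.Cruxes.ForwardTailCeiling.FwdShellBarrier
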